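import Literature.AlgebraicGeometry.Resolution.SemiStablePairFieldBaseChange
import Literature.AlgebraicGeometry.Resolution.FlatLocalRegularAscent
import HarnessLib

/-!
# (o25-δ2) The base-change square `Y' = Y ×ₖ Spec K → Y` at a point: the local data of `φ = 𝒪_{Y,g η'} → 𝒪_{Y',η'}`

Route `ResolutionOfSingularities/WeightedInvariant`, door crux `HypersurfaceCentreConstruction`
(stmt-ResolutionOfSingularities-19897) — helper toward ORDER (o25-δ) «`AbramovichQuekSchober2025_separableBaseChange`
in the kernel» (owner res-D-pv-025, assembly δ3), piece (δ2) «SQUARE → φ» (res-type-047, 2026-08-27).  For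
`f : Y → Spec k` locally of finite type, a field extension `K/k` that is FORMALLY SMOOTH and ESSENTIALLY OF FINITE
TYPE (this covers the finite separable extensions and the rational function fields `k(ℤʲ)` of the torus actions —
the general formally smooth case would need Matsumura's «`𝔪`-smooth ⇒ regular», not in the tree), a cartesian square
`g : Y' → Y`, `f' : Y' → Spec K` over `Spec K → Spec k`, and a point `η' ∈ Y'`:

* `formallySmooth_and_essFiniteType_stalk_of_chart` — a general chart lemma: if `c : Spec T → Y'` hits `η'` with an
  isomorphism on stalks and `c ≫ g = Spec(𝒪_{Y,g η'} → T) ≫ (Spec 𝒪_{Y,g η'} → Y)` for a formally smooth,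
  essentially of finite type `𝒪_{Y,g η'}`-algebra `T`, then so is `𝒪_{Y',η'}` over `𝒪_{Y,g η'}` (via
  `g.stalkMap η'`); the compatibility of `g.stalkMap η'` with `T → T_t` is checked after `Spec`
  (`Scheme.SpecMap_stalkMap_fromSpecStalk`), cancelling the monomorphism `Spec 𝒪_{Y,g η'} → Y`;
* `formallySmooth_and_essFiniteType_stalk_of_isPullback` — applied to the chart
  `Spec (𝒪_{Y,g η'} ⊗ₖ K) → Y ×ₖ Spec K ≅ Y'` (Literature `stalkTensorChart`);
* `map_maximalIdeal_eq_of_formallySmooth_of_ringKrullDim_eq`, `formallySmooth_residueField_of_map_maximalIdeal_eq`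
  — local algebra: for a flat, formally smooth, essentially of finite type local homomorphism `O → B` of
  Noetherian local rings with `dim O = dim B`, `𝔪_O B = 𝔪_B` (flat going-down: the fibre ring, regular by
  `isRegularLocalRing_of_formallySmooth_of_essFiniteType`, has dimension `0`), and then `κ(O) → κ(B)` is formally
  smooth (`κ(B) = κ(O) ⊗_O B`);
* `separableBaseChange_localData` — **(δ2)**: with `𝒪_{Y,g η'}` regular and `dim 𝒪_{Y,g η'} = dim 𝒪_{Y',η'}`:
  (i) `𝔪.map φ = 𝔪'`, (ii) `𝒪_{Y',η'}` regular (Literature `IsRegularLocalRing.of_flat_of_map_maximalIdeal_eq`),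
  (iii) `φ` flat, (iv) `κ(g η') → κ(η')` formally smooth for `(ResidueField.map φ).toAlgebra`;
  and (v) `locallyOfFiniteType_of_isPullback : LocallyOfFiniteType f'`.

No definitions.  Nothing here is a claim about Hironaka's problem or about any manuscript under adjudication;
AI-written, weaker than expert review.
-/

noncomputable section

set_option linter.dupNamespace false -- mandated namespace of this single-conjunct summit

namespace Summit.ResolutionOfSingularities.ResolutionOfSingularities.Theorems.AQSBaseChange

universe u

open CategoryTheory CategoryTheory.Limits AlgebraicGeometry TopologicalSpace IsLocalRing Opposite TensorProduct
open Literature.AlgebraicGeometry.Resolution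

/-! ## A chart `Spec T → Y'` through `η'` computes `𝒪_{Y',η'}` as an `𝒪_{Y,g η'}`-algebra -/

section Chart

variable {Y Y' : Scheme.{u}} (g : Y' ⟶ Y) (η' : Y') (T : Type u) [CommRing T]
  [Algebra (Y.presheaf.stalk (g η')) T]
  (c : Spec (.of T) ⟶ Y') (t : ↑(Spec (.of T))) (ht : c t = η') [IsIso (c.stalkMap t)]
  (hc : c ≫ g = Spec.map (CommRingCat.ofHom (algebraMap (Y.presheaf.stalk (g η')) T)) ≫
    Y.fromSpecStalk (g η'))
include ht hc

/-- **Chart lemma.**  If `c : Spec T → Y'` hits `η'` at `t` with `c.stalkMap t` an isomorphism and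
`c ≫ g = Spec (𝒪_{Y,g η'} → T) ≫ (Spec 𝒪_{Y,g η'} → Y)` for an `𝒪_{Y,g η'}`-algebra `T` that is formally smooth
and essentially of finite type, then `𝒪_{Y',η'}` — an `𝒪_{Y,g η'}`-algebra through `g.stalkMap η'` — is formally
smooth and essentially of finite type: it is `𝒪_{Y,g η'}`-isomorphic to the local ring `T_t` (the compatibility
of `g.stalkMap η'` with `T → T_t` is checked after `Spec`, cancelling the monomorphism `Spec 𝒪_{Y,g η'} → Y`).
[folklore] -/
theorem formallySmooth_and_essFiniteType_stalk_of_chart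
    [Algebra.FormallySmooth (Y.presheaf.stalk (g η')) T] [Algebra.EssFiniteType (Y.presheaf.stalk (g η')) T] :
    letI := (g.stalkMap η').hom.toAlgebra
    Algebra.FormallySmooth (Y.presheaf.stalk (g η')) (Y'.presheaf.stalk η') ∧
      Algebra.EssFiniteType (Y.presheaf.stalk (g η')) (Y'.presheaf.stalk η') := by
  letI := (g.stalkMap η').hom.toAlgebra
  -- the local ring `T_t` of `Spec T` at `t`
  let St : Type u := ↥((Spec (.of T)).presheaf.stalk t)
  letI : Algebra T St := (StructureSheaf.toStalk T t).hom.toAlgebra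
  haveI : IsLocalization.AtPrime St t.asIdeal := StructureSheaf.IsLocalization.to_stalk T t
  letI algO : Algebra (Y.presheaf.stalk (g η')) St :=
    ((algebraMap T St).comp (algebraMap (Y.presheaf.stalk (g η')) T)).toAlgebra
  haveI : IsScalarTower (Y.presheaf.stalk (g η')) T St := IsScalarTower.of_algebraMap_eq fun _ => rfl
  haveI : Algebra.FormallySmooth T St := .of_isLocalization t.asIdeal.primeCompl
  haveI : Algebra.EssFiniteType T St := .of_isLocalization St t.asIdeal.primeCompl
  haveI : Algebra.FormallySmooth (Y.presheaf.stalk (g η')) St := .comp _ T St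
  haveI : Algebra.EssFiniteType (Y.presheaf.stalk (g η')) St := .comp _ T St
  -- the comparison `Ψ : 𝒪_{Y',η'} ⟶ T_t`
  have hsp : c t ⤳ η' := specializes_of_eq ht
  let Ψ : Y'.presheaf.stalk η' ⟶ (Spec (.of T)).presheaf.stalk t :=
    Y'.presheaf.stalkSpecializes hsp ≫ c.stalkMap t
  haveI : IsIso (Y'.presheaf.stalkSpecializes hsp) := by
    have : Y'.presheaf.stalkSpecializes hsp = (Y'.presheaf.stalkCongr (Inseparable.of_eq ht)).inv := rfl
    rw [this]; infer_instance
  haveI : IsIso Ψ := IsIso.comp_isIso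
  -- compatibility with the structure maps, checked after `Spec` against the mono `Spec 𝒪_{Y,g η'} → Y`
  have hcomp : g.stalkMap η' ≫ Ψ = CommRingCat.ofHom (algebraMap (Y.presheaf.stalk (g η')) St) := by
    apply Spec.map_injective
    rw [← cancel_mono (Y.fromSpecStalk (g η'))]
    simp only [Ψ, Spec.map_comp, Category.assoc]
    rw [Scheme.SpecMap_stalkMap_fromSpecStalk, Scheme.SpecMap_stalkSpecializes_fromSpecStalk_assoc,
      Scheme.SpecMap_stalkMap_fromSpecStalk_assoc, hc, Spec.fromSpecStalk_eq']
    exact (Spec.map_comp_assoc _ _ _).symm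
  -- the `𝒪_{Y,g η'}`-algebra isomorphism `𝒪_{Y',η'} ≃ T_t`
  let e : Y'.presheaf.stalk η' ≃ₐ[Y.presheaf.stalk (g η')] St :=
    AlgEquiv.ofRingEquiv (f := (asIso Ψ).commRingCatIsoToRingEquiv) (fun x => by
      change (g.stalkMap η' ≫ Ψ) x = _
      rw [hcomp]; rfl)
  exact ⟨Algebra.FormallySmooth.of_equiv e.symm, (Algebra.EssFiniteType.iff_of_algEquiv e.symm).mp inferInstance⟩

end Chart

/-! ## Local algebra: a flat, formally smooth, essentially of finite type local homomorphism -/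

section Algebra

variable (O B : Type u) [CommRing O] [IsLocalRing O] [IsNoetherianRing O] [CommRing B] [IsLocalRing B]
  [IsNoetherianRing B] [Algebra O B] [IsLocalHom (algebraMap O B)] [Algebra.FormallySmooth O B]

/-- **`𝔪_O B = 𝔪_B` when the dimensions agree.**  For a flat local homomorphism `O → B` of Noetherian local
rings, formally smooth and essentially of finite type, with `dim O = dim B`: by flat going-down
(`Ideal.height_eq_height_add_of_liesOver_of_hasGoingDown`) the fibre ring `B ⧸ 𝔪_O B` — formally smooth and
essentially of finite type over the residue field `κ(O)`, hence a regular local ring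
(`isRegularLocalRing_of_formallySmooth_of_essFiniteType`) — has dimension `0`, so it is a field and
`𝔪_O B = 𝔪_B`. [folklore] -/
theorem map_maximalIdeal_eq_of_formallySmooth_of_ringKrullDim_eq [Module.Flat O B] [Algebra.EssFiniteType O B]
    {d : ℕ} (hdO : ringKrullDim O = d) (hdB : ringKrullDim B = d) :
    (maximalIdeal O).map (algebraMap O B) = maximalIdeal B := by
  set I : Ideal B := (maximalIdeal O).map (algebraMap O B) with hI
  have hIle : I ≤ maximalIdeal B := Ideal.map_le_iff_le_comap.mpr fun a ha => map_nonunit _ a ha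
  -- `𝔪_B` lies over `𝔪_O`
  haveI hover : (maximalIdeal B).LiesOver (maximalIdeal O) :=
    ⟨by
      rw [Ideal.under_def]
      refine ((IsLocalRing.maximalIdeal.isMaximal _).eq_of_le ?_ ?_)
      · exact Ideal.IsPrime.ne_top (Ideal.IsPrime.comap _)
      · exact Ideal.map_le_iff_le_comap.mp hIle⟩
  -- heights: `ht 𝔪_B = ht 𝔪_O + ht (𝔪_B mod I)` by flat going-down, and `ht 𝔪_B = d = ht 𝔪_O`
  have hht := Ideal.height_eq_height_add_of_liesOver_of_hasGoingDown (maximalIdeal O) (maximalIdeal B)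
  have h1 : (maximalIdeal B).height = d := by
    have := IsLocalRing.maximalIdeal_height_eq_ringKrullDim (R := B)
    rw [hdB] at this; exact_mod_cast this
  have h2 : (maximalIdeal O).height = d := by
    have := IsLocalRing.maximalIdeal_height_eq_ringKrullDim (R := O)
    rw [hdO] at this; exact_mod_cast this
  rw [h1, h2] at hht
  have h0 : ((maximalIdeal B).map (Ideal.Quotient.mk I)).height = 0 := by
    have h3 : (d : ℕ∞) + ((maximalIdeal B).map (Ideal.Quotient.mk I)).height = (d : ℕ∞) + 0 := by
      rw [add_zero]; exact hht.symm
    exact (add_right_inj_of_ne_top (ENat.coe_ne_top d)).mp h3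
  -- the fibre ring `F = B ⧸ I`: local, formally smooth and essentially of finite type over `κ(O)`, so regular
  haveI : Nontrivial (B ⧸ I) :=
    Ideal.Quotient.nontrivial_iff.mpr (ne_top_of_le_ne_top (Ideal.IsPrime.ne_top inferInstance) hIle)
  haveI : IsLocalRing (B ⧸ I) := IsLocalRing.of_surjective' (Ideal.Quotient.mk I) Ideal.Quotient.mk_surjective
  have hmk : (maximalIdeal B).map (Ideal.Quotient.mk I) = maximalIdeal (B ⧸ I) :=
    IsLocalRing.map_maximalIdeal_of_surjective (Ideal.Quotient.mk I) Ideal.Quotient.mk_surjective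
  letI : Field (O ⧸ maximalIdeal O) := Ideal.Quotient.field (maximalIdeal O)
  haveI : Algebra.FormallySmooth (O ⧸ maximalIdeal O) (B ⧸ I) :=
    Algebra.FormallySmooth.of_equiv (Algebra.TensorProduct.quotIdealMapEquivQuotTensor B (maximalIdeal O)).symm
  haveI : Algebra.EssFiniteType (O ⧸ maximalIdeal O) (B ⧸ I) := inferInstance
  haveI hFreg : IsRegularLocalRing (B ⧸ I) :=
    isRegularLocalRing_of_formallySmooth_of_essFiniteType (O ⧸ maximalIdeal O) (B ⧸ I)
  -- of dimension `0`: a field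
  have hdimF : ringKrullDim (B ⧸ I) = 0 := by
    have := IsLocalRing.maximalIdeal_height_eq_ringKrullDim (R := B ⧸ I)
    rw [← hmk, h0] at this
    exact_mod_cast this.symm
  have hFbot : maximalIdeal (B ⧸ I) = ⊥ := by
    have h := hFreg.spanFinrank_maximalIdeal
    rw [hdimF] at h
    have h' : (maximalIdeal (B ⧸ I)).spanFinrank = 0 := by exact_mod_cast h
    exact (Submodule.spanFinrank_eq_zero_iff_eq_bot (IsNoetherian.noetherian _)).mp h'
  refine le_antisymm hIle ?_
  rw [← hmk, Ideal.map_eq_bot_iff_le_ker, Ideal.mk_ker] at hFbot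
  exact hFbot

omit [IsNoetherianRing O] [IsNoetherianRing B] in
/-- **The residue field extension of a formally smooth local homomorphism with `𝔪_O B = 𝔪_B` is formally
smooth**: `κ(B) = B ⧸ 𝔪_O B = κ(O) ⊗_O B` is a base change of the formally smooth `O → B`. [folklore] -/
theorem formallySmooth_residueField_of_map_maximalIdeal_eq
    (h : (maximalIdeal O).map (algebraMap O B) = maximalIdeal B) :
    letI := (IsLocalRing.ResidueField.map (algebraMap O B)).toAlgebra
    Algebra.FormallySmooth (ResidueField O) (ResidueField B) := by
  set I : Ideal B := (maximalIdeal O).map (algebraMap O B) with hI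
  haveI : Algebra.FormallySmooth (O ⧸ maximalIdeal O) (B ⧸ I) :=
    Algebra.FormallySmooth.of_equiv (Algebra.TensorProduct.quotIdealMapEquivQuotTensor B (maximalIdeal O)).symm
  letI alg : Algebra (O ⧸ maximalIdeal O) (ResidueField B) :=
    (IsLocalRing.ResidueField.map (algebraMap O B)).toAlgebra
  let e : (B ⧸ I) ≃ₐ[O ⧸ maximalIdeal O] ResidueField B :=
    AlgEquiv.ofRingEquiv (f := Ideal.quotEquivOfEq h) (fun x => by
      obtain ⟨o, rfl⟩ := Ideal.Quotient.mk_surjective x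
      rfl)
  have key : @Algebra.FormallySmooth (O ⧸ maximalIdeal O) (ResidueField B) _ _ alg :=
    Algebra.FormallySmooth.of_equiv e
  exact key

end Algebra

/-! ## The square `Y' = Y ×ₖ Spec K → Y` -/

section Square

variable {k : Type u} [Field k] {Y : Scheme.{u}} (f : Y ⟶ Spec (.of k))
  (K : Type u) [Field K] [Algebra k K] {Y' : Scheme.{u}} {f' : Y' ⟶ Spec (.of K)} {g : Y' ⟶ Y}
  (hsq : IsPullback g f' f (Spec.map (CommRingCat.ofHom (algebraMap k K))))
include hsq

variable [LocallyOfFiniteType f]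

/-- **(δ2)(v)** `f' : Y' → Spec K` is locally of finite type (a base change of `f`). [folklore] -/
theorem locallyOfFiniteType_of_isPullback : LocallyOfFiniteType f' := by
  rw [← hsq.isoPullback_hom_snd]
  infer_instance

/-- `Y'` is locally Noetherian. [folklore] -/
theorem isLocallyNoetherian_of_isPullback : IsLocallyNoetherian Y' :=
  haveI := locallyOfFiniteType_of_isPullback f K hsq
  LocallyOfFiniteType.isLocallyNoetherian f'

variable [Algebra.FormallySmooth k K] [Algebra.EssFiniteType k K]

omit [LocallyOfFiniteType f] in
/-- **`𝒪_{Y',η'}` is formally smooth and essentially of finite type over `𝒪_{Y,g η'}`** (through `g.stalkMap η'`),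
for `K/k` formally smooth and essentially of finite type: the chart `Spec (𝒪_{Y,g η'} ⊗ₖ K) → Y ×ₖ Spec K ≅ Y'`
through the local scheme at `g η'` (Literature `stalkTensorChart`) hits `η'` with isomorphic stalks, and the chart
lemma applies. [folklore] -/
theorem formallySmooth_and_essFiniteType_stalk_of_isPullback (η' : Y') :
    letI := (g.stalkMap η').hom.toAlgebra
    Algebra.FormallySmooth (Y.presheaf.stalk (g η')) (Y'.presheaf.stalk η') ∧
      Algebra.EssFiniteType (Y.presheaf.stalk (g η')) (Y'.presheaf.stalk η') := by
  set e := hsq.isoPullback with he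
  -- the chart through the local scheme at `y₀ = g η'`
  let T : Type u := StalkOver f (g η') ⊗[k] K
  letI algOT : Algebra (Y.presheaf.stalk (g η')) T :=
    (inferInstance : Algebra (StalkOver f (g η')) (StalkOver f (g η') ⊗[k] K))
  haveI : Algebra.FormallySmooth (Y.presheaf.stalk (g η')) T :=
    (inferInstance : Algebra.FormallySmooth (StalkOver f (g η')) (StalkOver f (g η') ⊗[k] K))
  haveI : Algebra.EssFiniteType (Y.presheaf.stalk (g η')) T :=
    (inferInstance : Algebra.EssFiniteType (StalkOver f (g η')) (StalkOver f (g η') ⊗[k] K))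
  let c : Spec (.of T) ⟶ Y' := stalkTensorChart K f (g η') ≫ e.inv
  -- a point `t` of the chart over `η'`
  have hy : pullback.fst f (specOfAlgebra k K) (e.hom η') ⤳ g η' := by
    rw [← Scheme.Hom.comp_apply, he, hsq.isoPullback_hom_fst]
  obtain ⟨t, hct⟩ := exists_stalkTensorChart_eq (E := K) f (g η') (e.hom η') hy
  have ht : c t = η' := by
    show (stalkTensorChart K f (g η') ≫ e.inv) t = η'
    rw [Scheme.Hom.comp_apply, hct, ← Scheme.Hom.comp_apply, Iso.hom_inv_id]
    rfl
  haveI i1 : IsIso (e.inv.stalkMap (stalkTensorChart K f (g η') t)) := inferInstance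
  haveI i2 : IsIso ((stalkTensorChart K f (g η')).stalkMap t) := isIso_stalkMap_stalkTensorChart K f (g η') t
  haveI : IsIso (c.stalkMap t) := by
    show IsIso ((stalkTensorChart K f (g η') ≫ e.inv).stalkMap t)
    rw [Scheme.Hom.stalkMap_comp]
    exact @IsIso.comp_isIso _ _ _ _ _ _ _ i1 i2
  have hc : c ≫ g = Spec.map (CommRingCat.ofHom (algebraMap (Y.presheaf.stalk (g η')) T)) ≫
      Y.fromSpecStalk (g η') := by
    have h1 : c ≫ g = stalkTensorChart K f (g η') ≫ pullback.fst f (specOfAlgebra k K) := by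
      show (stalkTensorChart K f (g η') ≫ e.inv) ≫ g = _
      rw [Category.assoc, he, hsq.isoPullback_inv_fst]
    have h2 : CommRingCat.ofHom (algebraMap (Y.presheaf.stalk (g η')) T) =
        CommRingCat.ofHom (Algebra.TensorProduct.includeLeftRingHom (R := k) (A := StalkOver f (g η'))
          (B := K)) := by
      congr 1
    rw [h1, h2, stalkTensorChart, specTensorChart_fst, StalkOver.fromSpec, StalkOver.iso, Iso.refl_hom]
    erw [Spec.map_id, Category.id_comp]
    rfl
  exact formallySmooth_and_essFiniteType_stalk_of_chart g η' T c t ht hc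

/-- **(δ2), the local data of the base-change square at a point.**  For `f : Y → Spec k` locally of finite
type, `K/k` formally smooth and essentially of finite type, a cartesian square `g : Y' = Y ×ₖ Spec K → Y`, and a
point `η' ∈ Y'` with `𝒪_{Y,g η'}` regular and `dim 𝒪_{Y,g η'} = dim 𝒪_{Y',η'}`, the local homomorphism
`φ = g.stalkMap η' : 𝒪_{Y,g η'} → 𝒪_{Y',η'}` satisfies: (i) `𝔪 𝒪_{Y',η'} = 𝔪'`; (ii) `𝒪_{Y',η'}` is regular;
(iii) `φ` is flat; (iv) the residue field extension `κ(g η') → κ(η')` is formally smooth. [folklore] -/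
theorem separableBaseChange_localData (η' : Y') (hreg : IsRegularLocalRing (Y.presheaf.stalk (g η')))
    {d : ℕ} (hdim : ringKrullDim (Y.presheaf.stalk (g η')) = d)
    (hdim' : ringKrullDim (Y'.presheaf.stalk η') = d) :
    (maximalIdeal (Y.presheaf.stalk (g η'))).map (g.stalkMap η').hom = maximalIdeal (Y'.presheaf.stalk η') ∧
      IsRegularLocalRing (Y'.presheaf.stalk η') ∧ (g.stalkMap η').hom.Flat ∧
      (letI := (IsLocalRing.ResidueField.map (g.stalkMap η').hom).toAlgebra
       Algebra.FormallySmooth (ResidueField (Y.presheaf.stalk (g η'))) (ResidueField (Y'.presheaf.stalk η'))) := by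
  haveI : IsLocallyNoetherian Y' := isLocallyNoetherian_of_isPullback f K hsq
  haveI : IsLocallyNoetherian Y := LocallyOfFiniteType.isLocallyNoetherian f
  -- `g` is flat: a base change of the flat `Spec K → Spec k`
  haveI : Flat g := by
    haveI : Flat (specOfAlgebra k K) := Flat.SpecMap_iff.mpr (RingHom.flat_algebraMap_iff.mpr inferInstance)
    rw [← hsq.isoPullback_hom_fst]
    infer_instance
  letI := (g.stalkMap η').hom.toAlgebra
  haveI : Module.Flat (Y.presheaf.stalk (g η')) (Y'.presheaf.stalk η') := Flat.stalkMap g η'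
  haveI : IsLocalHom (algebraMap (Y.presheaf.stalk (g η')) (Y'.presheaf.stalk η')) :=
    inferInstanceAs (IsLocalHom (g.stalkMap η').hom)
  obtain ⟨hfs, heft⟩ := formallySmooth_and_essFiniteType_stalk_of_isPullback f K hsq η'
  have h1 := map_maximalIdeal_eq_of_formallySmooth_of_ringKrullDim_eq (Y.presheaf.stalk (g η'))
    (Y'.presheaf.stalk η') hdim hdim'
  exact ⟨h1, IsRegularLocalRing.of_flat_of_map_maximalIdeal_eq _ _ h1, Flat.stalkMap g η',
    formallySmooth_residueField_of_map_maximalIdeal_eq _ _ h1⟩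

end Square

end Summit.ResolutionOfSingularities.ResolutionOfSingularities.Theorems.AQSBaseChange

end
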